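import Summits.QuantumFields.YangMills.Theorems.SwapVirialDeficitSwapRingSectorEvents
import Summits.QuantumFields.YangMills.Theorems.SwapVirialDeficitSwapRingCeiling
import Summits.QuantumFields.YangMills.Theorems.SwapVirialDeficitSwapRingCeilingBoxTwisted
import HarnessLib

/-!
# The odd σ-sectors have an EXPLICIT gap: defect `≥ 1/8`, hence the odd classes are VOID on `(0, (1248·L³)⁻²)` UNIFORMLY in `L`
# (first uniform-in-`L` piece of the hypothesis (S) of ✓`SharpSigma.swapGluedStiffness_of_principalClassSharpLaw`; crux ⟨stmt-QuantumFields-24197⟩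
# `SwapVirialDeficit.SwapGluedStiffness`; quantitative version of w2 g54's ✓`oddDefect_pos` / ✓`sigmaTwisted_odd_empty`, which used compactness)

For unit quaternions `a, b, t` the odd-sector defect `‖ab − ba‖ + ‖tb + at‖ + ‖ta − bt‖` is at least `1/8` (§1, explicit algebra:
`b' = tat⁻¹` is `e₁`-close to `b`; `S = tb't⁻¹` satisfies `‖S + a‖ ≤ e₁ + e₂`, so `|re a| ≤ (e₁+e₂)/2`; the pure parts `x, y` of `a, b'`
have equal norms, and `‖x − y‖·‖x + y‖ = ‖[x,y]‖ = ‖[a,b']‖ ≤ e₀ + 2e₁`, so `b'` is `√(e₀+2e₁)`-close to `a` or to `−a`; either way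
`‖S − a‖ ≤ 2(√(e₀+2e₁) + e₁ + e₂)` and `2 = ‖2a‖ ≤ ‖S + a‖ + ‖S − a‖` — impossible below `1/8`).  Hence (§2) the odd σ-twisted events are
EMPTY for `t < 1/24` with an explicit threshold, and (§3), through the signed box ✓`swapBox_of_swapRingDeficit_le` (`s = 52L³√u`) and w3's
Fubini ✓`ringMeasure_real_swapDeficit_le_le_box_of_box`, the odd classes `z 0 ≠ z 1` carry NO mass below `u < (1248·L³)⁻²`:
★★ `swap_oddSector_void_uniform` — a gap `F^S_z > (1248 L³)⁻²` polynomial in `L`, i.e. the odd half of (S) with `K₁ L^{q₁} = (1248L³)²`.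
HONEST LABEL: fixed-lattice bookkeeping with explicit constants; (P), the rest of (S), ⟨24197⟩, ⟨24194⟩ and every rung / summit stay OPEN; the
Yang–Mills mass gap is NOT proved; no summit is proved by a line.  THEOREMS ONLY (0 `def`, 0 `sorry`), standard axioms.
Seat ym-line-fcl-p3 g43 (cell ym-idea-1, free hands), `--supports stmt-QuantumFields-24197`.  References: [cite: tHooft1979]; [cite: Luscher1983, §2]; [folklore].
-/

set_option autoImplicit false

noncomputable section

open MeasureTheory Set
open scoped Quaternion ENNReal BigOperators Matrix
open Literature.MathematicalPhysics.QuantumFieldTheory hiding SU2 su2Quat_mul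
open Literature.MathematicalPhysics.QuantumLattice
open Summit.QuantumFields.YangMills.Theorems.FemtoTransferGap
open Summit.QuantumFields.YangMills.Theorems.FemtoTransferGap.TT
open Summit.QuantumFields.YangMills.Theorems.FemtoTransferGap.TwoLattice
open Summit.QuantumFields.YangMills.Theorems.FemtoTransferGap.TwoLattice.Flat
open Summit.QuantumFields.YangMills.Theorems.FemtoTransferGap.TwoLattice.Cov
open Summit.QuantumFields.YangMills.Theorems.VirialFluxGap.RingDeficit
open Summit.QuantumFields.YangMills.Theorems.ToronValleyVolume.Lojasiewicz
open Summit.QuantumFields.YangMills.Theorems.ToronValleyVolume.PeriodicRingCeiling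
open Summit.QuantumFields.YangMills.Theorems.SwapTwistDeficit.PeriodicRingFloor
open Summit.QuantumFields.YangMills.Theorems.SwapVirialDeficit.SwapRing
open Summit.QuantumFields.YangMills.Theorems.SwapVirialDeficit.SwapRingTwisted
open Summit.QuantumFields.YangMills.Theorems.SwapVirialDeficit.SwapRingSectors
open Summit.QuantumFields.YangMills.Theorems.SwapVirialDeficit.SigmaTwistedLetterFloor (norm_comm_le_of_near)

namespace Summit.QuantumFields.YangMills.Theorems.SwapVirialDeficit.OddSectorGap

/-! ## §1 Quaternion algebra: the odd defect is at least `1/8` -/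


/-- For pure quaternions of equal norm, `‖x − y‖²·‖x + y‖² = ‖xy − yx‖²` (Lagrange's identity). [folklore] -/
theorem norm_sub_sq_mul_norm_add_sq {x y : ℍ} (hx : x.re = 0) (hy : y.re = 0) (h : ‖x‖ ^ 2 = ‖y‖ ^ 2) :
    ‖x - y‖ ^ 2 * ‖x + y‖ ^ 2 = ‖x * y - y * x‖ ^ 2 := by
  rw [sq_norm_eq_sum_sq, sq_norm_eq_sum_sq, SwapTwistDeficit.ToronLog.norm_comm_sq]
  rw [sq_norm_eq_sum_sq, sq_norm_eq_sum_sq, hx, hy] at h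
  simp only [Quaternion.re_sub, Quaternion.imI_sub, Quaternion.imJ_sub, Quaternion.imK_sub, Quaternion.re_add, Quaternion.imI_add,
    Quaternion.imJ_add, Quaternion.imK_add, hx, hy]
  have h' : x.imI ^ 2 + x.imJ ^ 2 + x.imK ^ 2 = y.imI ^ 2 + y.imJ ^ 2 + y.imK ^ 2 := by linarith
  linear_combination (x.imI ^ 2 + x.imJ ^ 2 + x.imK ^ 2 - (y.imI ^ 2 + y.imJ ^ 2 + y.imK ^ 2)) * h'

/-- ★★ **The odd-sector defect is at least `1/8`** for unit quaternions `a, t` (and ANY `b`): there are no approximate solutions of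
`ab = ba`, `ta = bt`, `tb = −at` below total defect `1/8`. [cite: tHooft1979] -/
theorem oddDefect_ge_eighth_quat {a t : ℍ} (b : ℍ) (ha : ‖a‖ = 1) (ht : ‖t‖ = 1) :
    1 / 8 ≤ ‖a * b - b * a‖ + ‖t * b + a * t‖ + ‖t * a - b * t‖ := by
  by_contra hlt
  push Not at hlt
  have he₀ := norm_nonneg (a * b - b * a)
  have he₁ := norm_nonneg (t * a - b * t)
  have he₂ := norm_nonneg (t * b + a * t)
  have ht0 : t ≠ 0 := by
    intro h; rw [h, norm_zero] at ht; exact zero_ne_one ht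
  -- `b' = t a t⁻¹` is `e₁`-close to `b`
  set b' : ℍ := t * a * t⁻¹ with hb'
  have hnb' : ‖b'‖ = 1 := by rw [hb', norm_mul, norm_mul, norm_inv, ht, ha]; norm_num
  -- conjugation preserves the real part (inlined; the named lemma lives in `Literature.Geometry.GaugeTheory.BPST`)
  have hreconj : ∀ x : ℍ, (t * x * t⁻¹).re = x.re := by
    intro x
    have hc : (t * x * t⁻¹).re = (t⁻¹ * (t * x)).re := by simp only [Quaternion.re_mul]; ring
    rw [hc, ← mul_assoc, inv_mul_cancel₀ ht0, one_mul]
  have hreb' : b'.re = a.re := hreconj a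
  have h1 : ‖b - b'‖ = ‖t * a - b * t‖ := by
    have e : b - b' = (b * t - t * a) * t⁻¹ := by rw [hb', sub_mul, mul_inv_cancel_right₀ ht0]
    rw [e, norm_mul, norm_inv, ht, inv_one, mul_one, norm_sub_rev]
  -- `S = t b' t⁻¹` nearly equals `−a`
  set S : ℍ := t * b' * t⁻¹ with hS
  have h2 : ‖S + a‖ ≤ ‖t * a - b * t‖ + ‖t * b + a * t‖ := by
    have e : S + a = (t * b' + a * t) * t⁻¹ := by rw [hS, add_mul, mul_inv_cancel_right₀ ht0]
    rw [e, norm_mul, norm_inv, ht, inv_one, mul_one]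
    have e2 : t * b' + a * t = (t * b + a * t) + t * (b' - b) := by rw [mul_sub]; abel
    rw [e2]
    calc ‖t * b + a * t + t * (b' - b)‖ ≤ ‖t * b + a * t‖ + ‖t * (b' - b)‖ := norm_add_le _ _
      _ = ‖t * b + a * t‖ + ‖t * a - b * t‖ := by rw [norm_mul, ht, one_mul, norm_sub_rev, h1]
      _ = ‖t * a - b * t‖ + ‖t * b + a * t‖ := add_comm _ _
  -- hence `re a` is small
  have h3 : 2 * |a.re| ≤ ‖t * a - b * t‖ + ‖t * b + a * t‖ := by
    have hre : (S + a).re = 2 * a.re := by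
      rw [Quaternion.re_add, hS, hreconj, hreb']; ring
    have h := abs_re_le_norm (S + a)
    rw [hre, abs_mul, abs_two] at h
    exact h.trans h2
  -- `[a, b']` is small
  have h4 : ‖a * b' - b' * a‖ ≤ ‖a * b - b * a‖ + 2 * ‖t * a - b * t‖ := by
    have h := norm_comm_le_of_near (b := b') (c := b) ha
    rw [norm_sub_rev b' b, h1] at h
    exact h
  -- pure parts
  set x : ℍ := a - (a.re : ℍ) with hx
  set y : ℍ := b' - (a.re : ℍ) with hy
  have hxre : x.re = 0 := by simp [hx]
  have hyre : y.re = 0 := by simp [hy, hreb']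
  have hxn : ‖x‖ ^ 2 = 1 - a.re ^ 2 := by
    have h := sq_norm_eq_sum_sq a
    rw [ha, one_pow] at h
    rw [sq_norm_eq_sum_sq]
    simp only [hx, Quaternion.re_sub, Quaternion.imI_sub, Quaternion.imJ_sub, Quaternion.imK_sub, Quaternion.re_coe,
      Quaternion.imI_coe, Quaternion.imJ_coe, Quaternion.imK_coe, sub_zero, sub_self]
    linarith
  have hyn : ‖y‖ ^ 2 = 1 - a.re ^ 2 := by
    have h := sq_norm_eq_sum_sq b'
    rw [hnb', one_pow, hreb'] at h
    rw [sq_norm_eq_sum_sq]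
    simp only [hy, Quaternion.re_sub, Quaternion.imI_sub, Quaternion.imJ_sub, Quaternion.imK_sub, Quaternion.re_coe,
      Quaternion.imI_coe, Quaternion.imJ_coe, Quaternion.imK_coe, sub_zero, hreb', sub_self]
    linarith
  have hcomm : x * y - y * x = a * b' - b' * a := by
    have hca : (a.re : ℍ) * a = a * (a.re : ℍ) := Quaternion.coe_commutes a.re a
    have hcb : (a.re : ℍ) * b' = b' * (a.re : ℍ) := Quaternion.coe_commutes a.re b'
    simp only [hx, hy, sub_mul, mul_sub, hca, hcb]
    abel
  have hxy_sub : x - y = a - b' := by simp only [hx, hy]; abel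
  have hxy_add : x + y = a + b' - ((a.re : ℍ) + (a.re : ℍ)) := by simp only [hx, hy]; abel
  -- the product identity and the dichotomy
  have hprod : ‖x - y‖ ^ 2 * ‖x + y‖ ^ 2 ≤ (‖a * b - b * a‖ + 2 * ‖t * a - b * t‖) ^ 2 := by
    rw [norm_sub_sq_mul_norm_add_sq hxre hyre (by rw [hxn, hyn]), hcomm]
    exact pow_le_pow_left₀ (norm_nonneg _) h4 2
  set ρ : ℝ := Real.sqrt (‖a * b - b * a‖ + 2 * ‖t * a - b * t‖) with hρ
  have hρ0 : 0 ≤ ρ := Real.sqrt_nonneg _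
  have hρsq : ρ ^ 2 = ‖a * b - b * a‖ + 2 * ‖t * a - b * t‖ := Real.sq_sqrt (by positivity)
  have hρhalf : ρ < 1 / 2 := by nlinarith [hρsq, hlt, he₂]
  have hdich : ‖x - y‖ ≤ ρ ∨ ‖x + y‖ ≤ ρ := by
    by_contra hcon
    push Not at hcon
    obtain ⟨hm, hp⟩ := hcon
    have hm2 : ρ ^ 2 < ‖x - y‖ ^ 2 := pow_lt_pow_left₀ hm hρ0 two_ne_zero
    have hp2 : ρ ^ 2 < ‖x + y‖ ^ 2 := pow_lt_pow_left₀ hp hρ0 two_ne_zero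
    have hlt2 : ρ ^ 2 * ρ ^ 2 < ‖x - y‖ ^ 2 * ‖x + y‖ ^ 2 := mul_lt_mul'' hm2 hp2 (sq_nonneg _) (sq_nonneg _)
    rw [hρsq] at hlt2
    nlinarith [hprod, hlt2]
  -- `‖S − a‖` is small in both cases
  have hSa : ‖S - a‖ ≤ 2 * (ρ + (‖t * a - b * t‖ + ‖t * b + a * t‖)) := by
    have hconj : ∀ w : ℍ, ‖t * w * t⁻¹‖ = ‖w‖ := fun w => by rw [norm_mul, norm_mul, norm_inv, ht]; simp
    rcases hdich with hA | hB
    · -- `b'` near `a`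
      have hA' : ‖b' - a‖ ≤ ρ := by rw [norm_sub_rev, ← hxy_sub]; exact hA
      have e : S - a = t * (b' - a) * t⁻¹ + (b' - a) := by
        rw [hS, hb', mul_sub, sub_mul]
        simp only [mul_assoc]
        abel
      rw [e]
      calc ‖t * (b' - a) * t⁻¹ + (b' - a)‖ ≤ ‖t * (b' - a) * t⁻¹‖ + ‖b' - a‖ := norm_add_le _ _
        _ = 2 * ‖b' - a‖ := by rw [hconj]; ring
        _ ≤ 2 * (ρ + (‖t * a - b * t‖ + ‖t * b + a * t‖)) := by nlinarith [hA', he₁, he₂]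
    · -- `b'` near `−a`
      have hB' : ‖b' + a‖ ≤ ρ + (‖t * a - b * t‖ + ‖t * b + a * t‖) := by
        have e : b' + a = (x + y) + ((a.re : ℍ) + (a.re : ℍ)) := by rw [hxy_add]; abel
        have hrr : ‖(a.re : ℍ) + (a.re : ℍ)‖ = 2 * |a.re| := by
          rw [← Quaternion.coe_add, Quaternion.norm_coe, Real.norm_eq_abs, ← two_mul, abs_mul, abs_two]
        rw [e]
        calc ‖x + y + ((a.re : ℍ) + (a.re : ℍ))‖ ≤ ‖x + y‖ + ‖(a.re : ℍ) + (a.re : ℍ)‖ := norm_add_le _ _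
          _ = ‖x + y‖ + 2 * |a.re| := by rw [hrr]
          _ ≤ ρ + (‖t * a - b * t‖ + ‖t * b + a * t‖) := add_le_add hB h3
      have e : S - a = t * (b' + a) * t⁻¹ - (b' + a) := by
        rw [hS, hb', mul_add, add_mul]
        simp only [mul_assoc]
        abel
      rw [e]
      calc ‖t * (b' + a) * t⁻¹ - (b' + a)‖ ≤ ‖t * (b' + a) * t⁻¹‖ + ‖b' + a‖ := norm_sub_le _ _
        _ = 2 * ‖b' + a‖ := by rw [hconj]; ring
        _ ≤ 2 * (ρ + (‖t * a - b * t‖ + ‖t * b + a * t‖)) := by linarith [hB']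
  -- `2 = ‖2a‖ ≤ ‖S + a‖ + ‖S − a‖`: contradiction
  have htwo : (2 : ℝ) ≤ ‖S + a‖ + ‖S - a‖ := by
    have e : (S + a) - (S - a) = (2 : ℝ) • a := by rw [two_smul]; abel
    have h := norm_sub_le (S + a) (S - a)
    rw [e, norm_smul, Real.norm_eq_abs, abs_two, ha, mul_one] at h
    exact h
  linarith [htwo, h2, hSa, hρhalf, hlt, he₀, he₁, he₂]

/-- ★★ **The odd-sector defect is at least `1/8` on `SU(2)³`** (explicit version of ✓`oddDefect_pos`). [cite: tHooft1979] -/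
theorem oddDefect_ge_eighth (a b t : SU2) :
    1 / 8 ≤ ‖su2Quat a * su2Quat b - su2Quat b * su2Quat a‖ + ‖su2Quat t * su2Quat b + su2Quat a * su2Quat t‖ +
      ‖su2Quat t * su2Quat a - su2Quat b * su2Quat t‖ :=
  oddDefect_ge_eighth_quat (su2Quat b) (norm_su2Quat a) (norm_su2Quat t)

/-! ## §2 The odd σ-twisted events are empty below the explicit tolerance `1/24` -/

/-- ★ Sector `(ε₀, ε₁) = (−, +)`: empty for every `t < 1/24`. [cite: tHooft1979] -/
theorem sigmaTwisted_odd_empty_explicit {t : ℝ} (ht : t < 1 / 24) (C : Fin 4 → SU2) :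
    ¬ (‖su2Quat (C 0) * su2Quat (C 1) - su2Quat (C 1) * su2Quat (C 0)‖ ≤ t ∧
        ‖su2Quat (C 3) * su2Quat (C 1) + su2Quat (C 0) * su2Quat (C 3)‖ ≤ t ∧
          ‖su2Quat (C 3) * su2Quat (C 0) - su2Quat (C 1) * su2Quat (C 3)‖ ≤ t) := by
  intro h
  have hd := oddDefect_ge_eighth (C 0) (C 1) (C 3)
  linarith [h.1, h.2.1, h.2.2]

/-- ★ Sector `(ε₀, ε₁) = (+, −)`: empty for every `t < 1/24`. [cite: tHooft1979] -/
theorem sigmaTwisted_odd_empty_explicit' {t : ℝ} (ht : t < 1 / 24) (C : Fin 4 → SU2) :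
    ¬ (‖su2Quat (C 0) * su2Quat (C 1) - su2Quat (C 1) * su2Quat (C 0)‖ ≤ t ∧
        ‖su2Quat (C 3) * su2Quat (C 1) - su2Quat (C 0) * su2Quat (C 3)‖ ≤ t ∧
          ‖su2Quat (C 3) * su2Quat (C 0) + su2Quat (C 1) * su2Quat (C 3)‖ ≤ t) := by
  intro h
  have hd := oddDefect_ge_eighth (C 1) (C 0) (C 3)
  rw [norm_sub_rev (su2Quat (C 1) * su2Quat (C 0))] at hd
  linarith [h.1, h.2.1, h.2.2]

/-- ★ The signed Frobenius four-leader event of an odd sector `z 0 = 1, z 1 = 0` is EMPTY (hence Haar-null) for `s < 1/24`. [cite: tHooft1979] -/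
theorem haar_signedEvent_odd_eq_zero_explicit (z : Fin 3 → Bool) (h0 : z 0 = true) (h1 : z 1 = false) {s : ℝ} (hs : s < 1 / 24) :
    (Measure.pi fun _ : Fin 4 => haarProbability SU2) {C : Fin 4 → SU2 |
      (∀ μ ν : Fin 3, frobNorm (((C (Fin.castSucc μ) * C (Fin.castSucc ν) : SU2) : Matrix (Fin 2) (Fin 2) ℂ) -
        ((C (Fin.castSucc ν) * C (Fin.castSucc μ) : SU2) : Matrix (Fin 2) (Fin 2) ℂ)) ≤ s) ∧
      ∀ μ : Fin 3, frobNorm (((C (Fin.last 3) * C (Fin.castSucc (Equiv.swap (0 : Fin 3) 1 μ)) : SU2) : Matrix (Fin 2) (Fin 2) ℂ) -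
        ((centreElem (z μ) * C (Fin.castSucc μ) * C (Fin.last 3) : SU2) : Matrix (Fin 2) (Fin 2) ℂ)) ≤ s} = 0 := by
  have hempty : {C : Fin 4 → SU2 | ‖su2Quat (C 0) * su2Quat (C 1) - su2Quat (C 1) * su2Quat (C 0)‖ ≤ s ∧
      ‖su2Quat (C 3) * su2Quat (C 1) + su2Quat (C 0) * su2Quat (C 3)‖ ≤ s ∧
        ‖su2Quat (C 3) * su2Quat (C 0) - su2Quat (C 1) * su2Quat (C 3)‖ ≤ s} = ∅ :=
    Set.eq_empty_of_forall_notMem fun C hC => sigmaTwisted_odd_empty_explicit hs C hC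
  refine measure_mono_null (signedEvent_subset_odd z h0 h1 s) ?_
  rw [hempty]
  exact measure_empty

/-- ★ The signed Frobenius four-leader event of an odd sector `z 0 = 0, z 1 = 1` is EMPTY (hence Haar-null) for `s < 1/24`. [cite: tHooft1979] -/
theorem haar_signedEvent_odd'_eq_zero_explicit (z : Fin 3 → Bool) (h0 : z 0 = false) (h1 : z 1 = true) {s : ℝ} (hs : s < 1 / 24) :
    (Measure.pi fun _ : Fin 4 => haarProbability SU2) {C : Fin 4 → SU2 |
      (∀ μ ν : Fin 3, frobNorm (((C (Fin.castSucc μ) * C (Fin.castSucc ν) : SU2) : Matrix (Fin 2) (Fin 2) ℂ) -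
        ((C (Fin.castSucc ν) * C (Fin.castSucc μ) : SU2) : Matrix (Fin 2) (Fin 2) ℂ)) ≤ s) ∧
      ∀ μ : Fin 3, frobNorm (((C (Fin.last 3) * C (Fin.castSucc (Equiv.swap (0 : Fin 3) 1 μ)) : SU2) : Matrix (Fin 2) (Fin 2) ℂ) -
        ((centreElem (z μ) * C (Fin.castSucc μ) * C (Fin.last 3) : SU2) : Matrix (Fin 2) (Fin 2) ℂ)) ≤ s} = 0 := by
  have hempty : {C : Fin 4 → SU2 | ‖su2Quat (C 0) * su2Quat (C 1) - su2Quat (C 1) * su2Quat (C 0)‖ ≤ s ∧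
      ‖su2Quat (C 3) * su2Quat (C 1) - su2Quat (C 0) * su2Quat (C 3)‖ ≤ s ∧
        ‖su2Quat (C 3) * su2Quat (C 0) + su2Quat (C 1) * su2Quat (C 3)‖ ≤ s} = ∅ :=
    Set.eq_empty_of_forall_notMem fun C hC => sigmaTwisted_odd_empty_explicit' hs C hC
  refine measure_mono_null (signedEvent_subset_odd' z h0 h1 s) ?_
  rw [hempty]
  exact measure_empty

/-! ## §3 Ring level: the odd classes are void below `u < (1248·L³)⁻²`, uniformly in `L` -/

variable {L : ℕ} [NeZero L]

/-- ★★ **Odd classes are VOID near the valley, with an explicit polynomial threshold**: for `z 0 ≠ z 1` and `52L³√u < 1/24`,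
`μ_L{F^S_z ≤ u} = 0` (signed box ✓`swapBox_of_swapRingDeficit_le` + Fubini ✓`ringMeasure_real_swapDeficit_le_le_box_of_box` + §2).
[cite: tHooft1979] [cite: Luscher1983, §2] -/
theorem swap_oddSector_void (z : Fin 3 → Bool) (hz : z 0 ≠ z 1) {u : ℝ} (hu : 52 * (L : ℝ) ^ 3 * Real.sqrt u < 1 / 24) :
    (ringMeasure L).real {P | swapRingDeficit L z P ≤ u} = 0 := by
  have hbox := ringMeasure_real_swapDeficit_le_le_box_of_box (L := L) z
    (fun x => centreElem (Bool.xor (z 0 && decide (x 0 ≠ 0)) (Bool.xor (z 1 && decide (x 1 ≠ 0)) (z 2 && decide (x 2 ≠ 0)))))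
    (fun μ => centreElem (z μ)) (fun w r g h => swapBox_of_swapRingDeficit_le z u w r g h)
  have hzero : (Measure.pi fun _ : Fin 4 => haarProbability SU2) {C : Fin 4 → SU2 |
      (∀ μ ν : Fin 3, frobNorm (((C (Fin.castSucc μ) * C (Fin.castSucc ν) : SU2) : Matrix (Fin 2) (Fin 2) ℂ) -
        ((C (Fin.castSucc ν) * C (Fin.castSucc μ) : SU2) : Matrix (Fin 2) (Fin 2) ℂ)) ≤ 52 * (L : ℝ) ^ 3 * Real.sqrt u) ∧
      ∀ μ : Fin 3, frobNorm (((C (Fin.last 3) * C (Fin.castSucc (Equiv.swap (0 : Fin 3) 1 μ)) : SU2) : Matrix (Fin 2) (Fin 2) ℂ) -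
        ((centreElem (z μ) * C (Fin.castSucc μ) * C (Fin.last 3) : SU2) : Matrix (Fin 2) (Fin 2) ℂ)) ≤ 52 * (L : ℝ) ^ 3 * Real.sqrt u} = 0 := by
    by_cases h0 : z 0 = true
    · have h1 : z 1 = false := by
        cases h : z 1
        · rfl
        · exact absurd (h0.trans h.symm) hz
      exact haar_signedEvent_odd_eq_zero_explicit z h0 h1 hu
    · have h0' : z 0 = false := by cases h : z 0 <;> simp_all
      have h1 : z 1 = true := by
        cases h : z 1
        · exact absurd (h0'.trans h.symm) hz
        · rfl
      exact haar_signedEvent_odd'_eq_zero_explicit z h0' h1 hu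
  refine le_antisymm (hbox.trans ?_) measureReal_nonneg
  rw [measureReal_def, hzero, ENNReal.toReal_zero, zero_mul]

/-- ★★ **Uniform form**: for `z 0 ≠ z 1` and `u < (1248·L³)⁻²` the sublevel set `{F^S_z ≤ u}` is `μ_L`-null — the odd half of hypothesis (S)
of ✓`swapGluedStiffness_of_principalClassSharpLaw` with the polynomial window constant `(1248L³)²`. [cite: tHooft1979] [cite: Luscher1983, §2] -/
theorem swap_oddSector_void_uniform (z : Fin 3 → Bool) (hz : z 0 ≠ z 1) {u : ℝ} (hu : u < ((1248 * (L : ℝ) ^ 3) ^ 2)⁻¹) :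
    (ringMeasure L).real {P | swapRingDeficit L z P ≤ u} = 0 := by
  refine swap_oddSector_void z hz ?_
  have hL : (0 : ℝ) < (L : ℝ) := Nat.cast_pos.2 (NeZero.pos L)
  have hA : (0 : ℝ) < 1248 * (L : ℝ) ^ 3 := by positivity
  have hsqrt : Real.sqrt u < (1248 * (L : ℝ) ^ 3)⁻¹ := by
    rcases le_or_gt 0 u with hu0 | hu0
    · calc Real.sqrt u < Real.sqrt (((1248 * (L : ℝ) ^ 3) ^ 2)⁻¹) := Real.sqrt_lt_sqrt hu0 hu
        _ = (1248 * (L : ℝ) ^ 3)⁻¹ := by rw [← inv_pow, Real.sqrt_sq (inv_nonneg.2 hA.le)]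
    · rw [Real.sqrt_eq_zero'.2 hu0.le]; positivity
  calc 52 * (L : ℝ) ^ 3 * Real.sqrt u < 52 * (L : ℝ) ^ 3 * (1248 * (L : ℝ) ^ 3)⁻¹ := mul_lt_mul_of_pos_left hsqrt (by positivity)
    _ = 1 / 24 := by field_simp; ring

end Summit.QuantumFields.YangMills.Theorems.SwapVirialDeficit.OddSectorGap

end
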